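import Summits.FinalStateConjecture.FinalStateConjecture.Theorems.TameCensorship.Negative.ExistentialContent
import Summits.FinalStateConjecture.FinalStateConjecture.Theorems.WeakCosmicCensorshipMGHD.Negative.LocalFamilies
import Literature.Geometry.Lorentzian.AdmissibleMGHDExistence

/-!
# Route PhotonSphereChannels · item `TameCensorship` (stmt-FinalStateConjecture-10047) —
# prover-side reductions (helper file, `--supports`; the item itself is an open problem)

The crux `Summit.FinalStateConjecture.FinalStateConjecture.Theses.PhotonSphereChannels.TameCensorship`
(K3 of the route) asserts, for every connected Hausdorff second countable `3`-manifold `Σ`,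
Christodoulou-genericity (codimension `≥ 1`, curve form, relative to `admissibleVacuumData Σ`) of
the property "an MGHD exists ∧ every MGHD has complete `𝓘⁺`, no extremal-Kerr remnant and
`C³`-bounded outer geometry". It contains weak cosmic censorship over the repaired carrier
`VacuumCauchyDevelopment` and is an OPEN PROBLEM; no proof or refutation is claimed here. This file
lands the two structural facts a prover (or the planner restating K3) needs, both `sorry`-free:

* §1–§2 **K3 modulo MGHD existence.** Curve-genericity is insensitive to a conjunct that holds on
  the whole admissible class (`isChristodoulouGeneric_and_iff_of_forall`, pure logic). Hence, under
  MGHD existence for admissible data — verbatim the shared route statement `MGHDExists`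
  (stmt-FinalStateConjecture-9937), which the Literature named fact
  `choquetBruhat_geroch_exists_mghd_cauchy` (Choquet-Bruhat–Geroch 1969, Thm. 3; undischarged)
  yields by `choquetBruhat_geroch_exists_mghd_cauchy.forall_mem_admissibleVacuumData` —
  `TameCensorship` is EQUIVALENT to its `∀`-MGHD part alone
  (`tameCensorship_iff_forall_of_mghdExists`): the anti-vacuity conjunct `∃ 𝒟, 𝒟.IsMaximal`,
  which gives the crux its existential content (`Negative/ExistentialContent.lean`), is exactly the
  published theorem, and what remains is the purely conjectural generic statement (complete `𝓘⁺` +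
  dynamical third law + a-priori tameness). This is the split "named fact ⊕ conjecture" of the item.
* §3 **Local families suffice.** The typed genericity asks for a smooth injective admissible family
  on ALL of `ℝ¹`; in practice one builds a family for small parameters only. Precomposition with a
  smooth parameter map preserves `IsSmoothDataFamily` (`isSmoothDataFamily_comp`), and squashing
  `ℝ¹` onto a small parameter interval by `c ↦ (ε·arctan(c₀)/2) e₀` turns a family that is
  injective, admissible and non-exceptional for `|c₀| < ε` into a witness of
  `HasCodimAtLeastIn … 1` (`hasCodimAtLeastIn_one_of_local`, `isChristodoulouGeneric_one_of_local`).

No definition is introduced; nothing is restated as a fact. (buildfix 2026-08-20, row B-9: since route rev 15 the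
item is stmt-FinalStateConjecture-17431, TAME genericity; §2 now carries one `def` — the record of the pre-rev-15
statement stmt-FinalStateConjecture-10047 its two reductions were accepted for — and `isSmoothDataFamily_comp` became an
`alias` of its landed twin in `WeakCosmicCensorshipMGHD/Negative/LocalFamilies`; all accepted statements unchanged.)
-/

noncomputable section

open Manifold Bundle Set
open scoped ContDiff Topology

-- D-0017: single-problem summit, `Summit.<S>.<S>.…` by design; the Summits library sets
-- `weak.linter.dupNamespace = false`, repeated here for standalone elaboration (`lean check`).
set_option linter.dupNamespace false

namespace Summit.FinalStateConjecture.FinalStateConjecture.Theorems.PhotonSphereChannels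

open Literature.Geometry.Lorentzian
-- (kept from the accepted file; since route rev 15 the unqualified `TameCensorship` below resolves to the
-- pre-rev-15 record declared in THIS namespace, §2 — namespace resolution precedes this `open`)
open Summit.FinalStateConjecture.FinalStateConjecture.Theses.PhotonSphereChannels (TameCensorship)

/-! ## §1 Pure logic of curve-genericity -/

section Logic

variable {E : Type*} [NormedAddCommGroup E] [NormedSpace ℝ E] {H : Type*} [TopologicalSpace H]
  {I : ModelWithCorners ℝ E H} {X : Type*} [TopologicalSpace X] [ChartedSpace H X]
  [IsManifold I ∞ X]

/-- Properties that agree on the admissible class `𝓓` have the same Christodoulou-genericity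
(their exceptional sets inside `𝓓` coincide, and the witnessing families are the same). -/
theorem isChristodoulouGeneric_congr {𝓓 : Set (InitialDataSet I X)}
    {P Q : InitialDataSet I X → Prop} (h : ∀ d ∈ 𝓓, (P d ↔ Q d)) (m : ℕ) :
    InitialDataSet.IsChristodoulouGeneric 𝓓 P m ↔ InitialDataSet.IsChristodoulouGeneric 𝓓 Q m := by
  constructor
  · intro hP d hd
    obtain ⟨F, hF, h0, hinj, hadm, hexc⟩ := hP d ⟨hd.1, fun hp ↦ hd.2 ((h d hd.1).1 hp)⟩
    exact ⟨F, hF, h0, hinj, hadm,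
      fun c hc hmem ↦ hexc c hc ⟨hmem.1, fun hp ↦ hmem.2 ((h _ hmem.1).1 hp)⟩⟩
  · intro hQ d hd
    obtain ⟨F, hF, h0, hinj, hadm, hexc⟩ := hQ d ⟨hd.1, fun hq ↦ hd.2 ((h d hd.1).2 hq)⟩
    exact ⟨F, hF, h0, hinj, hadm,
      fun c hc hmem ↦ hexc c hc ⟨hmem.1, fun hq ↦ hmem.2 ((h _ hmem.1).2 hq)⟩⟩

/-- **A conjunct holding on the whole admissible class is invisible to genericity**: if `A d` for
every `d ∈ 𝓓`, then `A ∧ C` is Christodoulou-generic in `𝓓` iff `C` is. -/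
theorem isChristodoulouGeneric_and_iff_of_forall {𝓓 : Set (InitialDataSet I X)}
    {A C : InitialDataSet I X → Prop} (hA : ∀ d ∈ 𝓓, A d) (m : ℕ) :
    InitialDataSet.IsChristodoulouGeneric 𝓓 (fun d ↦ A d ∧ C d) m ↔
      InitialDataSet.IsChristodoulouGeneric 𝓓 C m :=
  isChristodoulouGeneric_congr (fun d hd ↦ ⟨And.right, fun hc ↦ ⟨hA d hd, hc⟩⟩) m

end Logic

/-! ## §2 `TameCensorship` modulo MGHD existence on admissible data -/

/-- **Record of the PRE-rev-15 statement of the route item `TameCensorship`** (stmt-FinalStateConjecture-10047,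
route `PhotonSphereChannels`, K3) — NOT the live route item. Until route rev 15 (2026-08-16T23:19Z) the crux was
the plain (topology-free) Christodoulou-genericity `InitialDataSet.IsChristodoulouGeneric (admissibleVacuumData Σ) Q 1`
of the bundled property `Q` below; rev 15 re-typed it, with the SAME `Q` (byte-identical), to the strictly stronger
TAME genericity `InitialDataSet.IsTameChristodoulouGeneric … Q 1` (see the item's docstring in the route file). The two
§2 reductions below were accepted against the old statement and are `Iff`-bookkeeping of exactly that plain form
(tame genericity admits no such split: it is not `∧`-closed), so since rev 15 they no longer elaborated against the
by-name `TameCensorship` and this module — with its importers — stopped building from source (buildfix lane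
2026-08-19/20, row B-9). The old statement is re-created HERE, in this file's own namespace: namespace resolution
precedes the `open … (TameCensorship)` above, so the statement text of the two theorems is unchanged and now
denotes this record, i.e. precisely the proposition they were accepted for. Body: the LEDGER SIGNATURE of
stmt-FinalStateConjecture-10047 VERBATIM (closed·retired, replaced 2026-08-16T23:19Z by stmt-FinalStateConjecture-17431 =
the live `Theses.PhotonSphereChannels.TameCensorship`), i.e. the current route body with `IsTameChristodoulouGeneric`
read `IsChristodoulouGeneric` (also kernel-witnessed by the pre-rev-15 read-back `tameCensorship_iff_tameProperty := Iff.rfl`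
in `Cruxes/TameCensorship/Lines/cures-commute-by-causality.lean`, whose `TameProperty` is this `Q`).
Nothing else in this file, and no importer, names `TameCensorship` unqualified. -/
def TameCensorship : Prop :=
  ∀ (X : Type) [TopologicalSpace X] [ChartedSpace Literature.Geometry.Lorentzian.E3 X] [IsManifold (modelWithCornersSelf ℝ Literature.Geometry.Lorentzian.E3) ((⊤ : ℕ∞) : WithTop ℕ∞) X] [T2Space X] [SecondCountableTopology X] [ConnectedSpace X], Literature.Geometry.Lorentzian.InitialDataSet.IsChristodoulouGeneric (Literature.Geometry.Lorentzian.admissibleVacuumData X) (fun D => (∃ 𝒟 : Literature.Geometry.Lorentzian.VacuumCauchyDevelopment D, 𝒟.IsMaximal) ∧ ∀ 𝒟 : Literature.Geometry.Lorentzian.VacuumCauchyDevelopment D, 𝒟.IsMaximal → _root_.Summit.FinalStateConjecture.HasCompleteNullInfinity 𝒟.toCauchyDevelopment ∧ ((∀ (Λ : Literature.Geometry.Lorentzian.lorentzGroup) (c : Literature.Geometry.Lorentzian.E4) (M a : ℝ), Literature.Geometry.Lorentzian.Kerr.IsExtremal M a → ¬ ∃ (τ₀ : ℝ) (Ψ :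 (Literature.Geometry.Lorentzian.boostedKerrBackground Λ c M a).domain → 𝒟.carrier), 𝒟.toSpacetime.IsLateChart (Literature.Geometry.Lorentzian.boostedKerrBackground Λ c M a) Set.univ τ₀ Ψ ∧ ∀ R : ℝ, Filter.Tendsto (fun τ => 𝒟.toSpacetime.truncDeviationCk (Literature.Geometry.Lorentzian.boostedKerrBackground Λ c M a) Ψ 2 R τ) Filter.atTop (nhds 0)) ∧ ∀ [𝒟.metric.HasLeviCivita], let outer : Set 𝒟.carrier := 𝒟.metric.causalFuture 𝒟.timeOrientation (Set.range 𝒟.embed) ∩ {q | ∃ (p : X) (γ : ℝ → 𝒟.carrier) (dom : Set ℝ), 𝒟.metric.IsNormalisedNullRayFrom 𝒟.timeOrientation 𝒟.embed 𝒟.normal p γ dom ∧ ¬ BddAbove dom ∧ q ∈ 𝒟.metric.chronologicalPast 𝒟.timeOrientation (γ '' (dom ∩ Set.Ici 0))}; ∃ r₀ : ℝ, 0 < r₀ ∧ ∃ Λ : NNReal, ∀ q ∈ outer, let U : TopologicalSpace.Opens Literature.Geometry.Lorentzian.E4 := ⟨Metric.ball (0 : Literature.Geometry.Lorentzian.E4)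 r₀, Metric.isOpen_ball⟩; ∃ Ψ : U → 𝒟.carrier, 𝒟.toSpacetime.IsLateChart (Literature.Geometry.Lorentzian.Minkowski.backgroundOn U) Set.univ (-r₀) Ψ ∧ (∃ x : U, (x : Literature.Geometry.Lorentzian.E4) = 0 ∧ Ψ x = q) ∧ Literature.Geometry.Lorentzian.supCkENorm (U : Set Literature.Geometry.Lorentzian.E4) 3 (𝒟.toSpacetime.deviationExtend (Literature.Geometry.Lorentzian.Minkowski.backgroundOn U) Ψ) ≤ (Λ : ENNReal) ∧ Literature.Geometry.Lorentzian.supCkENorm (U : Set Literature.Geometry.Lorentzian.E4) 0 (𝒟.toSpacetime.deviationExtend (Literature.Geometry.Lorentzian.Minkowski.backgroundOn U) Ψ) ≤ 1 / 2)) 1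

/-- **K3 (pre-rev-15 record `TameCensorship` above) modulo MGHD existence.** Under MGHD existence for admissible data — the hypothesis is,
verbatim, the shared route statement `MGHDExists` (stmt-FinalStateConjecture-9937), supplied from
the Literature named fact by `choquetBruhat_geroch_exists_mghd_cauchy.forall_mem_admissibleVacuumData`
(Choquet-Bruhat–Geroch 1969, Thm. 3) — `TameCensorship` is equivalent to the Christodoulou-genericity
of its `∀`-MGHD part alone: every maximal vacuum Cauchy development has complete `𝓘⁺` (sojourn
form), no extremal-Kerr remnant and `C³`-bounded outer geometry at a uniform scale. The right-hand
side is the conjectural content of the crux (weak cosmic censorship + dynamical third law + a-priori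
tameness as one curve-generic property); the anti-vacuity conjunct is the published theorem. -/
theorem tameCensorship_iff_forall_of_mghdExists
    (hM : ∀ (X : Type) [TopologicalSpace X] [ChartedSpace E3 X] [IsManifold (𝓡 3) ∞ X] [T2Space X]
      [SecondCountableTopology X] [ConnectedSpace X], ∀ D ∈ admissibleVacuumData X,
      ∃ 𝒟 : VacuumCauchyDevelopment D, 𝒟.IsMaximal) :
    TameCensorship ↔
      ∀ (X : Type) [TopologicalSpace X] [ChartedSpace E3 X] [IsManifold (𝓡 3) ∞ X] [T2Space X]
        [SecondCountableTopology X] [ConnectedSpace X],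
        InitialDataSet.IsChristodoulouGeneric (admissibleVacuumData X)
          (fun D ↦ ∀ 𝒟 : VacuumCauchyDevelopment D, 𝒟.IsMaximal →
            _root_.Summit.FinalStateConjecture.HasCompleteNullInfinity 𝒟.toCauchyDevelopment ∧
            ((∀ (Λ : lorentzGroup) (c : E4) (M a : ℝ), Kerr.IsExtremal M a →
              ¬ ∃ (τ₀ : ℝ) (Ψ : (boostedKerrBackground Λ c M a).domain → 𝒟.carrier),
                𝒟.toSpacetime.IsLateChart (boostedKerrBackground Λ c M a) Set.univ τ₀ Ψ ∧
                ∀ R : ℝ, Filter.Tendsto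
                  (fun τ ↦ 𝒟.toSpacetime.truncDeviationCk (boostedKerrBackground Λ c M a) Ψ 2 R τ)
                  Filter.atTop (nhds 0)) ∧
            ∀ [𝒟.metric.HasLeviCivita],
              let outer : Set 𝒟.carrier :=
                𝒟.metric.causalFuture 𝒟.timeOrientation (Set.range 𝒟.embed) ∩
                  {q | ∃ (p : X) (γ : ℝ → 𝒟.carrier) (dom : Set ℝ),
                    𝒟.metric.IsNormalisedNullRayFrom 𝒟.timeOrientation 𝒟.embed 𝒟.normal p γ
                      dom ∧ ¬ BddAbove dom ∧
                    q ∈ 𝒟.metric.chronologicalPast 𝒟.timeOrientation (γ '' (dom ∩ Set.Ici 0))}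
              ∃ r₀ : ℝ, 0 < r₀ ∧ ∃ Λ : NNReal, ∀ q ∈ outer,
                let U : TopologicalSpace.Opens E4 := ⟨Metric.ball (0 : E4) r₀, Metric.isOpen_ball⟩
                ∃ Ψ : U → 𝒟.carrier,
                  𝒟.toSpacetime.IsLateChart (Minkowski.backgroundOn U) Set.univ (-r₀) Ψ ∧
                  (∃ x : U, (x : E4) = 0 ∧ Ψ x = q) ∧
                  supCkENorm (U : Set E4) 3
                    (𝒟.toSpacetime.deviationExtend (Minkowski.backgroundOn U) Ψ) ≤ (Λ : ENNReal) ∧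
                  supCkENorm (U : Set E4) 0
                    (𝒟.toSpacetime.deviationExtend (Minkowski.backgroundOn U) Ψ) ≤ 1 / 2)) 1 := by
  -- buildfix 2026-08-20 (ops-buildfix lane, row B-9): `TameCensorship` is the pre-rev-15 record above
  -- (this file's namespace); the proof is unchanged but for the name being unfolded.
  unfold TameCensorship
  refine ⟨fun h X _ _ _ _ _ _ ↦ ?_, fun h X _ _ _ _ _ _ ↦ ?_⟩
  · exact (isChristodoulouGeneric_and_iff_of_forall
      (A := fun D ↦ ∃ 𝒟 : VacuumCauchyDevelopment D, 𝒟.IsMaximal) (hM X) 1).1 (h X)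
  · exact (isChristodoulouGeneric_and_iff_of_forall
      (A := fun D ↦ ∃ 𝒟 : VacuumCauchyDevelopment D, 𝒟.IsMaximal) (hM X) 1).2 (h X)

/-- The same reduction with the Literature named fact in place of the route statement:
under `choquetBruhat_geroch_exists_mghd_cauchy` (Choquet-Bruhat–Geroch 1969, Thm. 3; an
undischarged named fact of the tree), `TameCensorship` (the pre-rev-15 record above, i.e. the PLAIN
curve-genericity form of K3 — not the live, tame route item) follows from — and implies — the
genericity of its `∀`-MGHD part. CONDITIONAL (trust base: Choquet-Bruhat–Geroch 1969, Thm. 3). -/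
theorem tameCensorship_of_choquetBruhatGeroch_of_forall
    (hCBG : choquetBruhat_geroch_exists_mghd_cauchy)
    (h : ∀ (X : Type) [TopologicalSpace X] [ChartedSpace E3 X] [IsManifold (𝓡 3) ∞ X] [T2Space X]
        [SecondCountableTopology X] [ConnectedSpace X],
        InitialDataSet.IsChristodoulouGeneric (admissibleVacuumData X)
          (fun D ↦ ∀ 𝒟 : VacuumCauchyDevelopment D, 𝒟.IsMaximal →
            _root_.Summit.FinalStateConjecture.HasCompleteNullInfinity 𝒟.toCauchyDevelopment ∧
            ((∀ (Λ : lorentzGroup) (c : E4) (M a : ℝ), Kerr.IsExtremal M a →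
              ¬ ∃ (τ₀ : ℝ) (Ψ : (boostedKerrBackground Λ c M a).domain → 𝒟.carrier),
                𝒟.toSpacetime.IsLateChart (boostedKerrBackground Λ c M a) Set.univ τ₀ Ψ ∧
                ∀ R : ℝ, Filter.Tendsto
                  (fun τ ↦ 𝒟.toSpacetime.truncDeviationCk (boostedKerrBackground Λ c M a) Ψ 2 R τ)
                  Filter.atTop (nhds 0)) ∧
            ∀ [𝒟.metric.HasLeviCivita],
              let outer : Set 𝒟.carrier :=
                𝒟.metric.causalFuture 𝒟.timeOrientation (Set.range 𝒟.embed) ∩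
                  {q | ∃ (p : X) (γ : ℝ → 𝒟.carrier) (dom : Set ℝ),
                    𝒟.metric.IsNormalisedNullRayFrom 𝒟.timeOrientation 𝒟.embed 𝒟.normal p γ
                      dom ∧ ¬ BddAbove dom ∧
                    q ∈ 𝒟.metric.chronologicalPast 𝒟.timeOrientation (γ '' (dom ∩ Set.Ici 0))}
              ∃ r₀ : ℝ, 0 < r₀ ∧ ∃ Λ : NNReal, ∀ q ∈ outer,
                let U : TopologicalSpace.Opens E4 := ⟨Metric.ball (0 : E4) r₀, Metric.isOpen_ball⟩
                ∃ Ψ : U → 𝒟.carrier,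
                  𝒟.toSpacetime.IsLateChart (Minkowski.backgroundOn U) Set.univ (-r₀) Ψ ∧
                  (∃ x : U, (x : E4) = 0 ∧ Ψ x = q) ∧
                  supCkENorm (U : Set E4) 3
                    (𝒟.toSpacetime.deviationExtend (Minkowski.backgroundOn U) Ψ) ≤ (Λ : ENNReal) ∧
                  supCkENorm (U : Set E4) 0
                    (𝒟.toSpacetime.deviationExtend (Minkowski.backgroundOn U) Ψ) ≤ 1 / 2)) 1) :
    TameCensorship :=
  (tameCensorship_iff_forall_of_mghdExists hCBG.forall_mem_admissibleVacuumData).2 h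

/-! ## §3 Local one-parameter families suffice for codimension `≥ 1` -/

section Families

variable {E : Type*} [NormedAddCommGroup E] [NormedSpace ℝ E] {H : Type*} [TopologicalSpace H]
  {I : ModelWithCorners ℝ E H} {X : Type*} [TopologicalSpace X] [ChartedSpace H X]
  [IsManifold I ∞ X]

/-- Precomposition with a smooth map of parameter spaces preserves joint smoothness of a family of
initial data sets (`IsSmoothDataFamily` is smoothness of `(c, x) ↦ h_c(x), k_c(x)`; compose with
`(c', x) ↦ (φ c', x)`). -/
-- buildfix 2026-08-20 (row B-9): this lemma is, statement for statement, the landed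
-- `WeakCosmicCensorshipMGHD.Negative.isSmoothDataFamily_comp` (Theorems/WeakCosmicCensorshipMGHD/Negative/LocalFamilies.lean,
-- now imported); the gate's dedup lint refuses a second copy, so the name is kept as an `alias` of that
-- declaration (same type; every use below and in importers is unchanged).
alias isSmoothDataFamily_comp :=
  Summit.FinalStateConjecture.FinalStateConjecture.Theorems.WeakCosmicCensorshipMGHD.Negative.isSmoothDataFamily_comp

/-- The coordinate `c ↦ c 0` on `ℝ¹ = EuclideanSpace ℝ (Fin 1)` is smooth. -/
theorem contDiff_euclideanOne_apply :
    ContDiff ℝ ∞ (fun c : EuclideanSpace ℝ (Fin 1) ↦ c 0) :=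
  (EuclideanSpace.proj (𝕜 := ℝ) (ι := Fin 1) 0).contDiff

/-- **Squashing `ℝ¹` into a small parameter interval.** For `ε > 0` the map
`σ(c) = (ε · arctan(c₀) / 2) e₀` is smooth, injective, fixes `0`, and has `|σ(c)₀| < ε`. -/
theorem squash_spec {ε : ℝ} (hε : 0 < ε) :
    ContDiff ℝ ∞ (fun c : EuclideanSpace ℝ (Fin 1) ↦
        (ε * Real.arctan (c 0) / 2) • EuclideanSpace.single (0 : Fin 1) (1 : ℝ)) ∧
      Function.Injective (fun c : EuclideanSpace ℝ (Fin 1) ↦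
        (ε * Real.arctan (c 0) / 2) • EuclideanSpace.single (0 : Fin 1) (1 : ℝ)) ∧
      (ε * Real.arctan ((0 : EuclideanSpace ℝ (Fin 1)) 0) / 2) •
          EuclideanSpace.single (0 : Fin 1) (1 : ℝ) = 0 ∧
      ∀ c : EuclideanSpace ℝ (Fin 1),
        |((ε * Real.arctan (c 0) / 2) • EuclideanSpace.single (0 : Fin 1) (1 : ℝ)) 0| < ε := by
  refine ⟨?_, ?_, ?_, ?_⟩
  · exact ((contDiff_const.mul (Real.contDiff_arctan.comp contDiff_euclideanOne_apply)).div_const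
      _).smul contDiff_const
  · intro c c' h
    have h0 := congrArg (fun v : EuclideanSpace ℝ (Fin 1) ↦ v 0) h
    simp only [PiLp.smul_apply, PiLp.single_apply, if_true, smul_eq_mul, mul_one] at h0
    have h1 : Real.arctan (c 0) = Real.arctan (c' 0) := by
      have hε' : ε ≠ 0 := hε.ne'
      field_simp at h0
      linarith [h0]
    have h2 : c 0 = c' 0 := Real.arctan_injective h1
    ext i
    fin_cases i
    exact h2
  · simp
  · intro c
    have hlt : |Real.arctan (c 0)| < 2 := by
      rw [abs_lt]
      constructor
      · linarith [Real.neg_pi_div_two_lt_arctan (c 0), Real.pi_le_four]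
      · linarith [Real.arctan_lt_pi_div_two (c 0), Real.pi_le_four]
    simp only [PiLp.smul_apply, PiLp.single_apply, if_true, smul_eq_mul, mul_one]
    rw [abs_div, abs_mul, abs_of_pos hε, abs_two]
    nlinarith [abs_nonneg (Real.arctan (c 0))]

/-- **Local families suffice (codimension `≥ 1`).** If through every exceptional datum `d ∈ 𝓔`
there is a jointly smooth one-parameter family `F` with `F 0 = d` which, FOR PARAMETERS
`|c₀| < ε` ONLY, is injective, stays in the admissible class `𝓓` and avoids `𝓔` off `c = 0`, then
`𝓔` has codimension at least `1` in `𝓓` in Christodoulou's (curve) sense: reparametrise by the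
squashing map of `squash_spec`. -/
theorem hasCodimAtLeastIn_one_of_local {𝓓 𝓔 : Set (InitialDataSet I X)}
    (h : ∀ d ∈ 𝓔, ∃ (ε : ℝ) (F : EuclideanSpace ℝ (Fin 1) → InitialDataSet I X), 0 < ε ∧
      InitialDataSet.IsSmoothDataFamily 1 F ∧ F 0 = d ∧
      (∀ c c' : EuclideanSpace ℝ (Fin 1), |c 0| < ε → |c' 0| < ε → F c = F c' → c = c') ∧
      (∀ c : EuclideanSpace ℝ (Fin 1), |c 0| < ε → F c ∈ 𝓓) ∧
      ∀ c : EuclideanSpace ℝ (Fin 1), c ≠ 0 → |c 0| < ε → F c ∉ 𝓔) :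
    InitialDataSet.HasCodimAtLeastIn 𝓓 𝓔 1 := by
  intro d hd
  obtain ⟨ε, F, hε, hF, h0, hinj, hadm, hexc⟩ := h d hd
  obtain ⟨hσs, hσi, hσ0, hσlt⟩ := squash_spec hε
  set σ : EuclideanSpace ℝ (Fin 1) → EuclideanSpace ℝ (Fin 1) :=
    fun c ↦ (ε * Real.arctan (c 0) / 2) • EuclideanSpace.single (0 : Fin 1) (1 : ℝ) with hσ
  have hσ0' : σ 0 = 0 := hσ0
  have hσne : ∀ c, c ≠ 0 → σ c ≠ 0 := fun c hc h' ↦ hc (hσi (h'.trans hσ0'.symm))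
  refine ⟨F ∘ σ, isSmoothDataFamily_comp hF hσs, ?_, ?_, fun c ↦ hadm _ (hσlt c),
    fun c hc ↦ hexc _ (hσne c hc) (hσlt c)⟩
  · show F (σ 0) = d
    rw [hσ0', h0]
  · intro c c' hcc'
    exact hσi (hinj _ _ (hσlt c) (hσlt c') hcc')

/-- **Local families suffice for Christodoulou-genericity with codimension `1`**: the property `P`
is generic in `𝓓` as soon as through every admissible datum failing `P` there is a jointly smooth
family which, for small parameters only, is injective, admissible and satisfies `P` off `c = 0`. -/
theorem isChristodoulouGeneric_one_of_local {𝓓 : Set (InitialDataSet I X)}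
    {P : InitialDataSet I X → Prop}
    (h : ∀ d ∈ 𝓓, ¬ P d → ∃ (ε : ℝ) (F : EuclideanSpace ℝ (Fin 1) → InitialDataSet I X), 0 < ε ∧
      InitialDataSet.IsSmoothDataFamily 1 F ∧ F 0 = d ∧
      (∀ c c' : EuclideanSpace ℝ (Fin 1), |c 0| < ε → |c' 0| < ε → F c = F c' → c = c') ∧
      (∀ c : EuclideanSpace ℝ (Fin 1), |c 0| < ε → F c ∈ 𝓓) ∧
      ∀ c : EuclideanSpace ℝ (Fin 1), c ≠ 0 → |c 0| < ε → P (F c)) :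
    InitialDataSet.IsChristodoulouGeneric 𝓓 P 1 := by
  refine hasCodimAtLeastIn_one_of_local fun d hd ↦ ?_
  obtain ⟨ε, F, hε, hF, h0, hinj, hadm, hP⟩ := h d hd.1 hd.2
  exact ⟨ε, F, hε, hF, h0, hinj, hadm, fun c hc hcε hmem ↦ hmem.2 (hP c hc hcε)⟩

end Families

end Summit.FinalStateConjecture.FinalStateConjecture.Theorems.PhotonSphereChannels

end
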